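import Mathlib
import HarnessLib
import Summits.CriticalPhenomena.Ising3DConformalLimit.Theses.ArmDressing
import Summits.CriticalPhenomena.Ising3DConformalLimit.Theorems.ArmDressingEvenPatternDecouplingPatternBoxLimits
import Summits.CriticalPhenomena.Ising3DConformalLimit.Theorems.ArmDressingEvenPatternDecouplingPatternTransferDet
import Summits.CriticalPhenomena.Ising3DConformalLimit.Theorems.ArmDressingArmDressingGlueEdwardsSokal
import Literature.Probability.LatticeModels.IsingPlusEdwardsSokalNPointBox
import Literature.Probability.LatticeModels.CriticalFKIsingArmVanishes
import Literature.Probability.LatticeModels.CriticalCorrWellDefined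
import Literature.Probability.LatticeModels.PlusFreeComparison
import Literature.Probability.LatticeModels.PlusStateFKG

/-!
# `ArmDressing.EvenPatternDecoupling` — stub `stub_evenPatternLowerGKS` (GKS lower bound for the
# infinite-volume even pattern)

Support file for crux item stmt-CriticalPhenomena-16133 (line `registered`, skeleton revision 6):
the registered stub `stub_evenPatternLowerGKS`, proved. For `2k` points `z : Fin (k+k) → ℝ³`
(injective) and their lattice approximations `x_j = [z_j/δ] ∈ ℤ³`, eventually as `δ → 0⁺`,

`∏_{i<k} ⟨σ₀ σ_{x(k+i) - x(i)}⟩⁺_{β_c} ≤ Pr (k+k) ({x_j})_j EVEN`,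

the right side being the `L → ∞` limit of the wired critical FK-Ising box probabilities that every
open cluster of `Λ_L` contains an even number of the `x_j` (counted by index).

Proof.
1. GKS II in the infinite-volume plus state, iterated over the pairing `(i, k+i)`
   (`prod_twoPointPlus_le_plusExpect_spinMonomial`): `σ_a σ_b = σ_{{a} ∆ {b}}`, so
   `∏_j σ_{x_j} = ∏_i σ_{P_i} = σ_{∆_i P_i}` with `P_i = {x(i)} ∆ {x(k+i)}`, and
   `∏_i ⟨σ_{P_i}⟩⁺ ≤ ⟨σ_{∆_i P_i}⟩⁺` by `⟨σ_A⟩⁺⟨σ_B⟩⁺ ≤ ⟨σ_{A∆B}⟩⁺` (Friedli–Velenik 2017, Thm. 3.20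
   (3.22) in the limit, the tree's `plusCorr_mul_le`) and `⟨σ_A⟩⁺ ≥ 0`; finally
   `⟨σ_{P_i}⟩⁺ = ⟨σ_{x(i)}σ_{x(k+i)}⟩⁺ = ⟨σ₀σ_{x(k+i)-x(i)}⟩⁺` (translation invariance,
   `plusPair_eq_twoPointPlus_sub`). No distinctness of the points is needed here.
2. Edwards–Sokal with `+` boundary in infinite volume at `β_c(3)` (the landed
   `Cruxes.ArmDressingGlue.EdwardsSokalProof.stub_edwardsSokalIdentity`, Grimmett 2006 Thm. 1.16 /
   §4.2 with `m*(β_c) = 0`): `criticalCorr 3 n x = Pr n ({x_j})_j EVEN` for injective `x`.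
3. The lattice approximations of the injective family `z` are injective once `4δ` is below the
   least mutual distance of the `z_j` (`dist_mesh_latticeApprox_le`: `|δ[z/δ] - z| ≤ 2δ`).

References: S. Friedli, Y. Velenik, *Statistical Mechanics of Lattice Systems* (CUP 2017),
Thm. 3.17, Thm. 3.20; R. B. Griffiths, J. Math. Phys. 8 (1967); D. G. Kelly, S. Sherman, J. Math.
Phys. 9 (1968); G. Grimmett, *The Random-Cluster Model* (2006), Thm. 1.16, §4.2.
No definitions, no named facts.
-/

namespace Summit.CriticalPhenomena.Ising3DConformalLimit.Theorems.EvenPatternDecoupling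

open scoped Topology symmDiff
open MeasureTheory Finset Filter
open Literature.Probability.LatticeModels Literature.Probability.Percolation
open Literature.Barriers.CriticalPhenomena

/-! ### GKS II in the plus state, iterated over a pairing -/

/-- The pair observable is the spin product of the symmetric difference of the two singletons
(`σ_a σ_a = 1 = σ_∅`). [folklore] -/
theorem spinPair_eq_spinProduct_symmDiff' {V : Type*} [DecidableEq V] (a b : V) :
    spinPair a b = spinProduct (({a} : Finset V) ∆ {b}) := by
  funext σ
  rw [← spinProduct_mul_eq_spinProduct_symmDiff]
  simp [spinProduct, spinPair]

/-- **GKS II in the infinite-volume plus state, iterated over the pairing `(i, k+i)`**: for `β ≥ 0`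
and any `2k` sites `x` of `ℤ^d` (repetitions allowed),
`∏_{i<k} ⟨σ₀ σ_{x(k+i)-x(i)}⟩⁺_{β,0} ≤ ⟨∏_j σ_{x_j}⟩⁺_{β,0}` (Friedli–Velenik 2017, Thm. 3.20,
eq. (3.22), in the thermodynamic limit, with the translation invariance of the plus state,
Thm. 3.17). [cite: FriedliVelenik2017, Thm. 3.20, eq. (3.22), p. 109] -/
theorem prod_twoPointPlus_le_plusExpect_spinMonomial {d : ℕ} {β : ℝ} (hβ : 0 ≤ β) (k : ℕ)
    (x : Fin (k + k) → Site d) :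
    ∏ i : Fin k, twoPointPlus d β (x (Fin.natAdd k i) - x (Fin.castAdd k i)) ≤
      plusExpect d β 0 (spinMonomial x) := by
  classical
  -- the pair sets `P i = {x i} ∆ {x (k+i)}`
  set P : Fin k → Finset (Site d) := fun i => ({x (Fin.castAdd k i)} : Finset (Site d)) ∆
    {x (Fin.natAdd k i)} with hP
  have hpair : ∀ i, spinPair (x (Fin.castAdd k i)) (x (Fin.natAdd k i)) = spinProduct (P i) :=
    fun i => spinPair_eq_spinProduct_symmDiff' _ _
  have hcorr : ∀ i, plusCorr d β 0 (P i) =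
      twoPointPlus d β (x (Fin.natAdd k i) - x (Fin.castAdd k i)) := by
    intro i
    rw [← plusPair_eq_twoPointPlus_sub hβ, plusPair, plusCorr, hpair]
  -- GKS II by induction on the set of pairs
  have key : ∀ s : Finset (Fin k), ∃ S : Finset (Site d),
      (fun σ => ∏ i ∈ s, spinProduct (P i) σ) = spinProduct S ∧
        ∏ i ∈ s, plusCorr d β 0 (P i) ≤ plusCorr d β 0 S := by
    intro s
    induction s using Finset.induction_on with
    | empty =>
      refine ⟨∅, ?_, ?_⟩
      · funext σ
        rw [Finset.prod_empty, spinProduct_empty]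
      · rw [Finset.prod_empty, plusCorr_empty hβ le_rfl]
    | insert a s ha ih =>
      obtain ⟨S, hS, hle⟩ := ih
      refine ⟨P a ∆ S, ?_, ?_⟩
      · funext σ
        rw [Finset.prod_insert ha, show (∏ i ∈ s, spinProduct (P i) σ) = spinProduct S σ from
          congrFun hS σ, spinProduct_mul_eq_spinProduct_symmDiff]
      · rw [Finset.prod_insert ha]
        calc plusCorr d β 0 (P a) * ∏ i ∈ s, plusCorr d β 0 (P i)
            ≤ plusCorr d β 0 (P a) * plusCorr d β 0 S :=
              mul_le_mul_of_nonneg_left hle (plusCorr_nonneg hβ le_rfl _)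
          _ ≤ plusCorr d β 0 (P a ∆ S) := plusCorr_mul_le hβ le_rfl _ _
  obtain ⟨S, hS, hle⟩ := key Finset.univ
  -- the spin monomial is the spin product of `S`
  have hmono : spinMonomial x = spinProduct S := by
    rw [← hS]
    funext σ
    unfold spinMonomial
    rw [Fin.prod_univ_add, ← Finset.prod_mul_distrib]
    refine Finset.prod_congr rfl fun i _ => ?_
    have h := congrFun (hpair i) σ
    rwa [spinPair] at h
  calc ∏ i, twoPointPlus d β (x (Fin.natAdd k i) - x (Fin.castAdd k i))
      = ∏ i, plusCorr d β 0 (P i) := Finset.prod_congr rfl fun i _ => (hcorr i).symm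
    _ ≤ plusCorr d β 0 S := hle
    _ = plusExpect d β 0 (spinMonomial x) := by rw [plusCorr, hmono]

/-- **At `β_c`: the critical `2k`-point correlator dominates the product of the critical two-point
functions over the pairs `(i, k+i)`**, `∏_{i<k} ⟨σ₀σ_{x(k+i)-x(i)}⟩⁺_{β_c} ≤ ⟨∏_j σ_{x_j}⟩⁺_{β_c}`
(GKS II in the plus state). [cite: FriedliVelenik2017, Thm. 3.20, eq. (3.22), p. 109] -/
theorem prod_criticalTwoPoint_le_criticalCorr {d : ℕ} (k : ℕ) (x : Fin (k + k) → Site d) :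
    ∏ i : Fin k, criticalTwoPoint d (x (Fin.natAdd k i) - x (Fin.castAdd k i)) ≤
      criticalCorr d (k + k) x :=
  prod_twoPointPlus_le_plusExpect_spinMonomial (criticalBeta_nonneg d) k x

/-! ### The infinite-volume Edwards–Sokal identity, in plain form -/

/-- **Edwards–Sokal with `+` boundary in infinite volume at `β_c(3)`** (the landed clause (c) of the
support `InfiniteVolumeEdwardsSokal`, `stub_edwardsSokalIdentity`, with the route vocabulary
unfolded): for injective `x : Fin n → ℤ³`, `⟨∏_j σ_{x_j}⟩⁺_{β_c}` is the `L → ∞` limit (`limUnder`)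
of the wired critical FK-Ising box probabilities that every index class `{j | x_i ↔ x_j}` is even.
[cite: Grimmett2006, Thm. 1.16 and §4.2 eqs. (4.12)–(4.13)] -/
theorem criticalCorr_eq_limUnder_even {n : ℕ} (x : Fin n → Site 3) (hx : Function.Injective x) :
    criticalCorr 3 n x = limUnder atTop (fun L : ℕ =>
      (rcMeasure (boxGraph 3 L) (fkIsingParam (criticalBeta 3)) 2 (boxBoundary 3 L)).real
        {ω | (fun i j => ∃ u v : BoxV 3 L, u.1 ∈ ({x i} : Set (Site 3)) ∧
          v.1 ∈ ({x j} : Set (Site 3)) ∧ (openGraph ω).Reachable u v) ∈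
          {R : Fin n → Fin n → Prop | ∀ i, Even ({j : Fin n | R i j}.ncard)}}) :=
  Cruxes.ArmDressingGlue.EdwardsSokalProof.stub_edwardsSokalIdentity n x hx

/-! ### Lattice approximations of distinct points are eventually distinct -/

/-- For an injective finite family of points of `ℝ³`, the lattice approximations `[z_j/δ]` are
pairwise distinct for all small `δ > 0` (each `δ[z_j/δ]` is within `2δ` of `z_j`). [folklore] -/
theorem eventually_injective_latticeApprox {n : ℕ} {z : Fin n → EuclideanSpace ℝ (Fin 3)}
    (hz : Function.Injective z) :
    ∀ᶠ δ in 𝓝[>] (0 : ℝ), Function.Injective fun j => latticeApprox δ (z j) := by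
  have hsep : ∀ᶠ δ in 𝓝[>] (0 : ℝ), ∀ i j, i ≠ j → 4 * δ < dist (z i) (z j) := by
    refine eventually_all.2 fun i => eventually_all.2 fun j => ?_
    by_cases hij : i = j
    · exact Eventually.of_forall fun δ h => absurd hij h
    · have hpos : 0 < dist (z i) (z j) := dist_pos.2 (hz.ne hij)
      have ht : Tendsto (fun δ : ℝ => 4 * δ) (𝓝 0) (𝓝 0) := by
        simpa using (tendsto_id (x := 𝓝 (0 : ℝ))).const_mul 4
      exact ((ht.eventually (gt_mem_nhds hpos)).filter_mono nhdsWithin_le_nhds).mono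
        fun δ h _ => h
  filter_upwards [hsep, self_mem_nhdsWithin] with δ hδ hpos
  intro i j hij
  by_contra hne
  have h4 := hδ i j hne
  have hi := dist_mesh_latticeApprox_le (Set.mem_Ioi.1 hpos) (z i)
  have hj := dist_mesh_latticeApprox_le (Set.mem_Ioi.1 hpos) (z j)
  have heq : (latticeApprox δ (z i)) = latticeApprox δ (z j) := hij
  rw [heq] at hi
  have : dist (z i) (z j) ≤ 4 * δ :=
    calc dist (z i) (z j) ≤ dist (z i) (WithLp.toLp 2 fun l : Fin 3 =>
          δ * ((latticeApprox δ (z j) l : ℤ) : ℝ)) + dist (WithLp.toLp 2 fun l : Fin 3 =>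
          δ * ((latticeApprox δ (z j) l : ℤ) : ℝ)) (z j) := dist_triangle _ _ _
      _ ≤ 2 * δ + 2 * δ := add_le_add (by rwa [dist_comm]) hj
      _ = 4 * δ := by ring
  linarith

/-! ### Assembly in plain form -/

/-- **The stub in plain form**: for injective `z : Fin (k+k) → ℝ³`, eventually as `δ → 0⁺`,
`∏_{i<k} criticalTwoPoint 3 ([z(k+i)/δ] - [z(i)/δ])` is at most the infinite-volume probability that
every open cluster holds an even number of the `[z_j/δ]` (GKS II + infinite-volume Edwards–Sokal).
[cite: FriedliVelenik2017, Thm. 3.20, eq. (3.22), p. 109] -/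
theorem prod_criticalTwoPoint_le_limUnder_even (k : ℕ) (z : Fin (k + k) → EuclideanSpace ℝ (Fin 3))
    (hz : Function.Injective z) :
    ∀ᶠ δ in 𝓝[>] (0 : ℝ),
      (∏ i : Fin k, criticalTwoPoint 3
        (latticeApprox δ (z (Fin.natAdd k i)) - latticeApprox δ (z (Fin.castAdd k i)))) ≤
      limUnder atTop (fun L : ℕ =>
        (rcMeasure (boxGraph 3 L) (fkIsingParam (criticalBeta 3)) 2 (boxBoundary 3 L)).real
          {ω | (fun i j => ∃ u v : BoxV 3 L, u.1 ∈ ({latticeApprox δ (z i)} : Set (Site 3)) ∧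
            v.1 ∈ ({latticeApprox δ (z j)} : Set (Site 3)) ∧ (openGraph ω).Reachable u v) ∈
            {R : Fin (k + k) → Fin (k + k) → Prop | ∀ i, Even ({j : Fin (k + k) | R i j}.ncard)}}) := by
  refine (eventually_injective_latticeApprox hz).mono fun δ hδ => ?_
  exact (prod_criticalTwoPoint_le_criticalCorr k (fun j => latticeApprox δ (z j))).trans
    (criticalCorr_eq_limUnder_even (fun j => latticeApprox δ (z j)) hδ).le

/-! ### The stub -/

-- the registered stub signature is the crux's full `let` preamble, several binders of which
-- (`μ`, `mesh`, `disc`, `EVEN2`, `CROSS`, `fam`) are not used by this clause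
set_option linter.unusedVariables false in
/-- stub GKS of the line skeleton of crux `EvenPatternDecoupling` (line `registered`, revision 6),
PROVED: **the infinite-volume probability of the even pattern of `2k` distinct points dominates the
product of the critical two-point functions over the pairs `(z (castAdd i), z (natAdd i))`** —
`Pr[EVEN(z^δ)] = ⟨∏_j σ_{z_j^δ}⟩⁺_{β_c}` (Edwards–Sokal with `+` boundary in the wired limit, the
boundary arms vanish since `m*(β_c) = 0`) `≥ ∏_i ⟨σ_{z^δ(castAdd i)} σ_{z^δ(natAdd i)}⟩⁺_{β_c}`
(GKS II) `= ∏_i criticalTwoPoint 3 (z^δ(natAdd i) - z^δ(castAdd i))` (translation invariance),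
eventually as `δ → 0⁺` (so that the lattice points are distinct, `z` injective).
[cite: FriedliVelenik2017, Thm. 3.20, eq. (3.22), p. 109] -/
theorem stub_evenPatternLowerGKS : open Literature.Probability.LatticeModels Literature.Probability.Percolation Literature.Barriers.CriticalPhenomena Filter Topology in let E3:=EuclideanSpace ℝ (Fin 3); let μ : (L : ℕ)→MeasureTheory.Measure (BondConfig (BoxV 3 L)):=fun L=>rcMeasure (boxGraph 3 L) (fkIsingParam (criticalBeta 3)) 2 (boxBoundary 3 L); let PrL : (m : ℕ)→(Fin m→Set (Site 3))→Set (Fin m→Fin m→Prop)→ℕ→ℝ:=fun _ K R L=>(μ L).real {ω | (fun i j=>∃ x y : BoxV 3 L, x.1∈K i∧y.1∈K j∧(openGraph ω).Reachable x y)∈R}; let Pr : (m : ℕ)→(Fin m→Set (Site 3))→Set (Fin m→Fin m→Prop)→ℝ:=fun m K R=>limUnder atTop (PrL m K R); let mesh : ℝ→Site 3→E3:=fun δ z=>WithLp.toLp 2 fun i : Fin 3=>δ * (z i : ℝ); let disc : ℝ→Set E3→Set (Site 3):=fun δ A=>{x | mesh δ x∈A}; let EVEN : (n : ℕ)→Set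 (Fin n→Fin n→Prop):=fun n=>{R | ∀ i, Even ({j : Fin n | R i j}.ncard)}; let EVEN2 : (n : ℕ)→Set (Fin (n + n)→Fin (n + n)→Prop):=fun n=>{R | ∀ i : Fin n, Even ({j : Fin n | R (Fin.castAdd n i) (Fin.castAdd n j)}.ncard)}; let CROSS : (n : ℕ)→Set (Fin (n + n)→Fin (n + n)→Prop):=fun n=>{R | ∀ i : Fin n, R (Fin.castAdd n i) (Fin.natAdd n i)}; let pts : (n : ℕ)→ℝ→(Fin n→E3)→(Fin n→Set (Site 3)):=fun _ δ z j=>{latticeApprox δ (z j)}; let fam : (n : ℕ)→ℝ→(Fin n→Set E3)→(Fin n→Set E3)→(Fin (n + n)→Set (Site 3)):=fun _ δ A B=>Fin.append (fun j=>disc δ (A j)) (fun j=>disc δ (B j)); ∀ (k : ℕ) (z : Fin (k + k)→E3), Function.Injective z→∀ᶠ δ in 𝓝[>] 0, (∏ i : Fin k, criticalTwoPoint 3 (latticeApprox δ (z (Fin.natAdd k i)) - latticeApprox δ (z (Fin.castAdd k i))))≤Pr (k + k) (pts (k + k) δ z) (EVEN (k + k)) := by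
  intro E3 μ PrL Pr mesh disc EVEN EVEN2 CROSS pts fam k z hinj
  exact prod_criticalTwoPoint_le_limUnder_even k z hinj

end Summit.CriticalPhenomena.Ising3DConformalLimit.Theorems.EvenPatternDecoupling
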